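import Summits.CriticalPhenomena.PercolationContinuityZ3.Theorems.PercNearOneGluingNoHeavyLowerTailIncStarBranchLemmaStep
import Summits.CriticalPhenomena.PercolationContinuityZ3.Theorems.PercNearOneGluingNoHeavyLowerTailIncStarRootPairWalks
import HarnessLib

/-!
# Root-pair chords at a vertex whose tree holds at most two targets (FC case (c-i))

Support file for the Sahi programme (`--supports stmt-CriticalPhenomena-4575`, prover prim-sahi-p2 gen 19).  No definitions, no named
facts, no sorries; standard axioms.  Memo `prim-sahi-p2/PROOF-E3.md` (29d), (29p).

Root `s`, a vertex set `L ∌ s` joined to the rest only through `s` (no positive pair from `L` to `(L ∪ {s})ᶜ` — e.g. a tree of the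
environment forest), and the root pair `e = s(s, x)` at a vertex `x ∈ L`.  If at most two of the three targets lie in `L` then the chord of
`E₃({s↔a},{s↔b},{s↔c})` along `e` is nonnegative — in fact `E₃` is affine in `w e` when at most one target lies in `L`
(`rootPair_chord_of_oneNear`, `rootPair_chord_of_noneNear`), and for two near targets `a, b ∈ L`, `c ∉ L`
`E₃(w) − [(1−p)E₃(w[e↦0]) + pE₃(w[e↦1])] = p(1−p)·P(s↔c)·Δ_AΔ_B ≥ 0` (`rootPair_chord_of_twoNear`), `Δ_T = P_{w[e↦1]}(T) − P_{w[e↦0]}(T) ≥ 0`.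
No forest hypothesis is needed.  Tools: the block dictionary of `…IncStarBridgeEvents` (blocks `insert s L`, `Lᶜ` meeting in the cut vertex `s`),
block independence `IncStar.indep_blocks`-style (`prodBernoulli_real_inter_of_determinedBy`), the marginal lemma `IncStar.real_update_eq_of_determinedBy`
(far-block probabilities do not see `e`), one-bond decomposition and `tieLiftOne_real_zero_le_one`.
-/

noncomputable section

namespace Summit.CriticalPhenomena.PercolationContinuityZ3.Theorems

namespace IncStar

open MeasureTheory Set Literature.Probability.Percolation Literature.Probability.LatticeModels EdgeInduction
open scoped Classical

variable {n : ℕ}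

/-- **Root pair in a tree holding two of the targets** (`a, b ∈ L`, `c ∉ L`): the chord of `E₃` along `s(s,x)`, `x ∈ L`, is nonnegative. [this work] -/
theorem rootPair_chord_of_twoNear (w : Sym2 (Fin n) → unitInterval) (L : Set (Fin n)) {s x a b c : Fin n}
    (hsL : s ∉ L) (hxL : x ∈ L) (haL : a ∈ L) (hbL : b ∈ L) (hcL : c ∉ L)
    (hcross : ∀ y z : Fin n, y ∈ L → z ∉ L → z ≠ s → w s(y, z) = 0) :
    (1 - (w s(s, x) : ℝ)) * sahiE3 (prodBernoulli (Function.update w s(s, x) 0)) (openConn s a) (openConn s b) (openConn s c)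
      + (w s(s, x) : ℝ) * sahiE3 (prodBernoulli (Function.update w s(s, x) 1)) (openConn s a) (openConn s b) (openConn s c)
    ≤ sahiE3 (prodBernoulli w) (openConn s a) (openConn s b) (openConn s c) := by
  set e : Sym2 (Fin n) := s(s, x) with he_def
  set w0 := Function.update w e 0 with hw0
  set w1 := Function.update w e 1 with hw1
  have hm : ∀ X : Set (BondConfig (Fin n)), MeasurableSet X := fun _ => MeasurableSet.of_discrete
  have hs1 : s ∈ insert s L := Set.mem_insert s L
  have ha1 : a ∈ insert s L := Set.mem_insert_of_mem s haL
  have hb1 : b ∈ insert s L := Set.mem_insert_of_mem s hbL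
  set An : Set (BondConfig (Fin n)) := openConnIn (insert s L) s a
  set Bn : Set (BondConfig (Fin n)) := openConnIn (insert s L) s b
  set Cf : Set (BondConfig (Fin n)) := openConnIn Lᶜ s c
  -- cross pairs are not the root pair, and stay closed under every pinning of `e`
  have hcross' : ∀ (val : unitInterval) (y z : Fin n), y ∈ L → z ∉ L → z ≠ s → Function.update w e val s(y, z) = 0 := by
    intro val y z hy hz hzs
    have hne : s(y, z) ≠ e := by
      intro h
      rw [he_def, Sym2.eq_iff] at h
      rcases h with ⟨h1, -⟩ | ⟨-, h2⟩
      · exact hsL (h1 ▸ hy)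
      · exact hzs h2
    rw [Function.update_of_ne hne]
    exact hcross y z hy hz hzs
  -- dictionary under a pinned weight
  have dict : ∀ (val : unitInterval),
      (prodBernoulli (Function.update w e val)).real (openConn s a) = (prodBernoulli (Function.update w e val)).real An ∧
      (prodBernoulli (Function.update w e val)).real (openConn s b) = (prodBernoulli (Function.update w e val)).real Bn ∧
      (prodBernoulli (Function.update w e val)).real (openConn s c) = (prodBernoulli (Function.update w e val)).real Cf ∧
      (prodBernoulli (Function.update w e val)).real (openConn s a ∩ openConn s b) = (prodBernoulli (Function.update w e val)).real (An ∩ Bn) ∧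
      (prodBernoulli (Function.update w e val)).real (openConn s a ∩ openConn s c) = (prodBernoulli (Function.update w e val)).real (An ∩ Cf) ∧
      (prodBernoulli (Function.update w e val)).real (openConn s b ∩ openConn s c) = (prodBernoulli (Function.update w e val)).real (Bn ∩ Cf) ∧
      (prodBernoulli (Function.update w e val)).real (openConn s a ∩ openConn s b ∩ openConn s c)
        = (prodBernoulli (Function.update w e val)).real ((An ∩ Bn) ∩ Cf) := by
    intro val
    set wv := Function.update w e val
    set G : Set (BondConfig (Fin n)) := {ω | ∀ e', wv e' = 0 → e' ∉ ω}
    have hG1 : (prodBernoulli wv).real G = 1 := real_sureClosed wv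
    have hωG : ∀ ω ∈ G, ∀ y z : Fin n, y ∈ L → z ∉ L → z ≠ s → s(y, z) ∉ ω :=
      fun ω hω y z hy hz hzs => hω _ (hcross' val y z hy hz hzs)
    have cA : ∀ ω ∈ G, (ω ∈ openConn s a ↔ ω ∈ An) := fun ω hω => bridge_conn_ll L hsL (hωG ω hω) hs1 ha1
    have cB : ∀ ω ∈ G, (ω ∈ openConn s b ↔ ω ∈ Bn) := fun ω hω => bridge_conn_ll L hsL (hωG ω hω) hs1 hb1
    have cC : ∀ ω ∈ G, (ω ∈ openConn s c ↔ ω ∈ Cf) := fun ω hω => by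
      rw [bridge_conn_lr L hsL (hωG ω hω) hs1 hcL]
      exact ⟨fun h => h.2, fun h => ⟨⟨hs1, hs1, SimpleGraph.Reachable.refl _⟩, h⟩⟩
    refine ⟨real_congr_of_sure hG1 cA, real_congr_of_sure hG1 cB, real_congr_of_sure hG1 cC,
      real_congr_of_sure hG1 fun ω hω => ?_, real_congr_of_sure hG1 fun ω hω => ?_,
      real_congr_of_sure hG1 fun ω hω => ?_, real_congr_of_sure hG1 fun ω hω => ?_⟩
    · rw [Set.mem_inter_iff, Set.mem_inter_iff, cA ω hω, cB ω hω]
    · rw [Set.mem_inter_iff, Set.mem_inter_iff, cA ω hω, cC ω hω]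
    · rw [Set.mem_inter_iff, Set.mem_inter_iff, cB ω hω, cC ω hω]
    · rw [Set.mem_inter_iff, Set.mem_inter_iff, Set.mem_inter_iff, Set.mem_inter_iff, cA ω hω, cB ω hω, cC ω hω]
  -- independence of the blocks, and the far block does not see `e`
  have hdN : ∀ t : Fin n, DeterminedBy (openConnIn (insert s L) s t : Set (BondConfig (Fin n)))
      {z : Sym2 (Fin n) | ¬ z.IsDiag ∧ ∀ v ∈ z, v ∈ insert s L} := fun t => IncStarCutVertex.determinedBy_openConnIn_offDiag _ s t
  have hdF : DeterminedBy Cf {z : Sym2 (Fin n) | ¬ z.IsDiag ∧ ∀ v ∈ z, v ∈ Lᶜ} := IncStarCutVertex.determinedBy_openConnIn_offDiag _ s c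
  have indep : ∀ (val : unitInterval) {A : Set (BondConfig (Fin n))},
      DeterminedBy A {z : Sym2 (Fin n) | ¬ z.IsDiag ∧ ∀ v ∈ z, v ∈ insert s L} →
      (prodBernoulli (Function.update w e val)).real (A ∩ Cf)
        = (prodBernoulli (Function.update w e val)).real A * (prodBernoulli (Function.update w e val)).real Cf :=
    fun val _ hA => indep_blocks (Function.update w e val) L s hA hdF
  have he_far : e ∉ {z : Sym2 (Fin n) | ¬ z.IsDiag ∧ ∀ v ∈ z, v ∈ Lᶜ} := by
    rintro ⟨-, h⟩
    exact h x (by rw [he_def]; exact Sym2.mem_mk_right s x) hxL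
  have far0 : (prodBernoulli w0).real Cf = (prodBernoulli w).real Cf := real_update_eq_of_determinedBy hdF w he_far 0
  have far1 : (prodBernoulli w1).real Cf = (prodBernoulli w).real Cf := real_update_eq_of_determinedBy hdF w he_far 1
  -- one-bond decomposition
  have ob : ∀ A : Set (BondConfig (Fin n)),
      (prodBernoulli w).real A = (1 - (w e : ℝ)) * (prodBernoulli w0).real A + (w e : ℝ) * (prodBernoulli w1).real A := by
    intro A
    have hA : DeterminedBy A (↑(Finset.univ : Finset (Sym2 (Fin n))) : Set (Sym2 (Fin n))) := by
      rw [determinedBy_iff]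
      intro ω ω' h
      rw [Finset.coe_univ, Set.inter_univ, Set.inter_univ] at h
      rw [h]
    exact prodBernoulli_real_oneBond hA w (Finset.mem_univ e)
  -- monotonicity in the pinned pair
  have monoA : (prodBernoulli w0).real An ≤ (prodBernoulli w1).real An := by
    rw [← (dict 0).1, ← (dict 1).1]; exact tieLiftOne_real_zero_le_one w e (isUpperSet_openConn s a)
  have monoB : (prodBernoulli w0).real Bn ≤ (prodBernoulli w1).real Bn := by
    rw [← (dict 0).2.1, ← (dict 1).2.1]; exact tieLiftOne_real_zero_le_one w e (isUpperSet_openConn s b)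
  have hγ : 0 ≤ (prodBernoulli w).real Cf := measureReal_nonneg
  have hp0 : (0 : ℝ) ≤ w e := (w e).2.1
  have hp1 : (w e : ℝ) ≤ 1 := (w e).2.2
  -- assemble
  obtain ⟨a0, b0, c0, ab0, ac0, bc0, abc0⟩ := dict 0
  obtain ⟨a1, b1, c1, ab1, ac1, bc1, abc1⟩ := dict 1
  rw [sahiE3_def, sahiE3_def, sahiE3_def,
    ob (openConn s a ∩ openConn s b ∩ openConn s c), ob (openConn s a ∩ openConn s b), ob (openConn s a ∩ openConn s c),
    ob (openConn s b ∩ openConn s c), ob (openConn s a), ob (openConn s b), ob (openConn s c)]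
  simp only [← hw0, ← hw1] at a0 b0 c0 ab0 ac0 bc0 abc0 a1 b1 c1 ab1 ac1 bc1 abc1 ⊢
  rw [a0, b0, c0, ab0, ac0, bc0, abc0, a1, b1, c1, ab1, ac1, bc1, abc1,
    indep 0 ((hdN a).inter (hdN b)), indep 0 (hdN a), indep 0 (hdN b),
    indep 1 ((hdN a).inter (hdN b)), indep 1 (hdN a), indep 1 (hdN b)]
  simp only [← hw0, ← hw1]
  rw [far0, far1]
  nlinarith [mul_nonneg (mul_nonneg (mul_nonneg hp0 (sub_nonneg.2 hp1)) hγ) (mul_nonneg (sub_nonneg.2 monoA) (sub_nonneg.2 monoB)),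
    mul_nonneg hp0 (sub_nonneg.2 hp1), hγ, sub_nonneg.2 monoA, sub_nonneg.2 monoB]


/-- **Root pair in a tree holding exactly one of the targets** (`a ∈ L`, `b, c ∉ L`): `E₃` is affine in `w s(s,x)` (`E₃ = P(s↔a)·Cov`, the covariance
of the far events not seeing the pair), so the chord vanishes. [this work] -/
theorem rootPair_chord_of_oneNear (w : Sym2 (Fin n) → unitInterval) (L : Set (Fin n)) {s x a b c : Fin n}
    (hsL : s ∉ L) (hxL : x ∈ L) (haL : a ∈ L) (hbL : b ∉ L) (hcL : c ∉ L)
    (hcross : ∀ y z : Fin n, y ∈ L → z ∉ L → z ≠ s → w s(y, z) = 0) :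
    (1 - (w s(s, x) : ℝ)) * sahiE3 (prodBernoulli (Function.update w s(s, x) 0)) (openConn s a) (openConn s b) (openConn s c)
      + (w s(s, x) : ℝ) * sahiE3 (prodBernoulli (Function.update w s(s, x) 1)) (openConn s a) (openConn s b) (openConn s c)
    ≤ sahiE3 (prodBernoulli w) (openConn s a) (openConn s b) (openConn s c) := by
  set e : Sym2 (Fin n) := s(s, x) with he_def
  set w0 := Function.update w e 0 with hw0
  set w1 := Function.update w e 1 with hw1
  have hm : ∀ X : Set (BondConfig (Fin n)), MeasurableSet X := fun _ => MeasurableSet.of_discrete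
  have hs1 : s ∈ insert s L := Set.mem_insert s L
  have ha1 : a ∈ insert s L := Set.mem_insert_of_mem s haL
  set An : Set (BondConfig (Fin n)) := openConnIn (insert s L) s a
  set Fb : Set (BondConfig (Fin n)) := openConnIn Lᶜ s b
  set Fc : Set (BondConfig (Fin n)) := openConnIn Lᶜ s c
  have hcross' : ∀ (val : unitInterval) (y z : Fin n), y ∈ L → z ∉ L → z ≠ s → Function.update w e val s(y, z) = 0 := by
    intro val y z hy hz hzs
    have hne : s(y, z) ≠ e := by
      intro h
      rw [he_def, Sym2.eq_iff] at h
      rcases h with ⟨h1, -⟩ | ⟨-, h2⟩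
      · exact hsL (h1 ▸ hy)
      · exact hzs h2
    rw [Function.update_of_ne hne]
    exact hcross y z hy hz hzs
  have dict : ∀ (val : unitInterval),
      (prodBernoulli (Function.update w e val)).real (openConn s a) = (prodBernoulli (Function.update w e val)).real An ∧
      (prodBernoulli (Function.update w e val)).real (openConn s b) = (prodBernoulli (Function.update w e val)).real Fb ∧
      (prodBernoulli (Function.update w e val)).real (openConn s c) = (prodBernoulli (Function.update w e val)).real Fc ∧
      (prodBernoulli (Function.update w e val)).real (openConn s a ∩ openConn s b) = (prodBernoulli (Function.update w e val)).real (An ∩ Fb) ∧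
      (prodBernoulli (Function.update w e val)).real (openConn s a ∩ openConn s c) = (prodBernoulli (Function.update w e val)).real (An ∩ Fc) ∧
      (prodBernoulli (Function.update w e val)).real (openConn s b ∩ openConn s c) = (prodBernoulli (Function.update w e val)).real (Fb ∩ Fc) ∧
      (prodBernoulli (Function.update w e val)).real (openConn s a ∩ openConn s b ∩ openConn s c)
        = (prodBernoulli (Function.update w e val)).real (An ∩ (Fb ∩ Fc)) := by
    intro val
    set wv := Function.update w e val
    set G : Set (BondConfig (Fin n)) := {ω | ∀ e', wv e' = 0 → e' ∉ ω}
    have hG1 : (prodBernoulli wv).real G = 1 := real_sureClosed wv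
    have hωG : ∀ ω ∈ G, ∀ y z : Fin n, y ∈ L → z ∉ L → z ≠ s → s(y, z) ∉ ω :=
      fun ω hω y z hy hz hzs => hω _ (hcross' val y z hy hz hzs)
    have cA : ∀ ω ∈ G, (ω ∈ openConn s a ↔ ω ∈ An) := fun ω hω => bridge_conn_ll L hsL (hωG ω hω) hs1 ha1
    have cB : ∀ ω ∈ G, (ω ∈ openConn s b ↔ ω ∈ Fb) := fun ω hω => by
      rw [bridge_conn_lr L hsL (hωG ω hω) hs1 hbL]
      exact ⟨fun h => h.2, fun h => ⟨⟨hs1, hs1, SimpleGraph.Reachable.refl _⟩, h⟩⟩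
    have cC : ∀ ω ∈ G, (ω ∈ openConn s c ↔ ω ∈ Fc) := fun ω hω => by
      rw [bridge_conn_lr L hsL (hωG ω hω) hs1 hcL]
      exact ⟨fun h => h.2, fun h => ⟨⟨hs1, hs1, SimpleGraph.Reachable.refl _⟩, h⟩⟩
    refine ⟨real_congr_of_sure hG1 cA, real_congr_of_sure hG1 cB, real_congr_of_sure hG1 cC,
      real_congr_of_sure hG1 fun ω hω => ?_, real_congr_of_sure hG1 fun ω hω => ?_,
      real_congr_of_sure hG1 fun ω hω => ?_, real_congr_of_sure hG1 fun ω hω => ?_⟩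
    · rw [Set.mem_inter_iff, Set.mem_inter_iff, cA ω hω, cB ω hω]
    · rw [Set.mem_inter_iff, Set.mem_inter_iff, cA ω hω, cC ω hω]
    · rw [Set.mem_inter_iff, Set.mem_inter_iff, cB ω hω, cC ω hω]
    · rw [Set.mem_inter_iff, Set.mem_inter_iff, Set.mem_inter_iff, Set.mem_inter_iff, cA ω hω, cB ω hω, cC ω hω]; tauto
  have hdN : DeterminedBy An {z : Sym2 (Fin n) | ¬ z.IsDiag ∧ ∀ v ∈ z, v ∈ insert s L} := IncStarCutVertex.determinedBy_openConnIn_offDiag _ s a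
  have hdF : ∀ t : Fin n, DeterminedBy (openConnIn Lᶜ s t : Set (BondConfig (Fin n))) {z : Sym2 (Fin n) | ¬ z.IsDiag ∧ ∀ v ∈ z, v ∈ Lᶜ} :=
    fun t => IncStarCutVertex.determinedBy_openConnIn_offDiag _ s t
  have indep : ∀ (val : unitInterval) {B : Set (BondConfig (Fin n))},
      DeterminedBy B {z : Sym2 (Fin n) | ¬ z.IsDiag ∧ ∀ v ∈ z, v ∈ Lᶜ} →
      (prodBernoulli (Function.update w e val)).real (An ∩ B)
        = (prodBernoulli (Function.update w e val)).real An * (prodBernoulli (Function.update w e val)).real B :=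
    fun val _ hB => indep_blocks (Function.update w e val) L s hdN hB
  have he_far : e ∉ {z : Sym2 (Fin n) | ¬ z.IsDiag ∧ ∀ v ∈ z, v ∈ Lᶜ} := by
    rintro ⟨-, h⟩
    exact h x (by rw [he_def]; exact Sym2.mem_mk_right s x) hxL
  have far : ∀ (val : unitInterval) {B : Set (BondConfig (Fin n))}, DeterminedBy B {z : Sym2 (Fin n) | ¬ z.IsDiag ∧ ∀ v ∈ z, v ∈ Lᶜ} →
      (prodBernoulli (Function.update w e val)).real B = (prodBernoulli w).real B :=
    fun val _ hB => real_update_eq_of_determinedBy hB w he_far val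
  have ob : ∀ A : Set (BondConfig (Fin n)),
      (prodBernoulli w).real A = (1 - (w e : ℝ)) * (prodBernoulli w0).real A + (w e : ℝ) * (prodBernoulli w1).real A := by
    intro A
    have hA : DeterminedBy A (↑(Finset.univ : Finset (Sym2 (Fin n))) : Set (Sym2 (Fin n))) := by
      rw [determinedBy_iff]
      intro ω ω' h
      rw [Finset.coe_univ, Set.inter_univ, Set.inter_univ] at h
      rw [h]
    exact prodBernoulli_real_oneBond hA w (Finset.mem_univ e)
  obtain ⟨a0, b0, c0, ab0, ac0, bc0, abc0⟩ := dict 0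
  obtain ⟨a1, b1, c1, ab1, ac1, bc1, abc1⟩ := dict 1
  rw [sahiE3_def, sahiE3_def, sahiE3_def,
    ob (openConn s a ∩ openConn s b ∩ openConn s c), ob (openConn s a ∩ openConn s b), ob (openConn s a ∩ openConn s c),
    ob (openConn s b ∩ openConn s c), ob (openConn s a), ob (openConn s b), ob (openConn s c)]
  simp only [← hw0, ← hw1] at a0 b0 c0 ab0 ac0 bc0 abc0 a1 b1 c1 ab1 ac1 bc1 abc1 ⊢
  rw [a0, b0, c0, ab0, ac0, bc0, abc0, a1, b1, c1, ab1, ac1, bc1, abc1,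
    indep 0 ((hdF b).inter (hdF c)), indep 0 (hdF b), indep 0 (hdF c),
    indep 1 ((hdF b).inter (hdF c)), indep 1 (hdF b), indep 1 (hdF c)]
  simp only [← hw0, ← hw1]
  rw [far 0 (hdF b), far 0 (hdF c), far 0 ((hdF b).inter (hdF c)), far 1 (hdF b), far 1 (hdF c), far 1 ((hdF b).inter (hdF c))]
  apply le_of_eq
  ring

/-- **Root pair in a tree holding none of the targets**: `E₃` does not depend on `w s(s,x)`; the chord vanishes. [this work] -/
theorem rootPair_chord_of_noneNear (w : Sym2 (Fin n) → unitInterval) (L : Set (Fin n)) {s x a b c : Fin n}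
    (hsL : s ∉ L) (hxL : x ∈ L) (haL : a ∉ L) (hbL : b ∉ L) (hcL : c ∉ L)
    (hcross : ∀ y z : Fin n, y ∈ L → z ∉ L → z ≠ s → w s(y, z) = 0) :
    (1 - (w s(s, x) : ℝ)) * sahiE3 (prodBernoulli (Function.update w s(s, x) 0)) (openConn s a) (openConn s b) (openConn s c)
      + (w s(s, x) : ℝ) * sahiE3 (prodBernoulli (Function.update w s(s, x) 1)) (openConn s a) (openConn s b) (openConn s c)
    ≤ sahiE3 (prodBernoulli w) (openConn s a) (openConn s b) (openConn s c) := by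
  set e : Sym2 (Fin n) := s(s, x) with he_def
  have hm : ∀ X : Set (BondConfig (Fin n)), MeasurableSet X := fun _ => MeasurableSet.of_discrete
  have hs1 : s ∈ insert s L := Set.mem_insert s L
  have hcross' : ∀ (val : unitInterval) (y z : Fin n), y ∈ L → z ∉ L → z ≠ s → Function.update w e val s(y, z) = 0 := by
    intro val y z hy hz hzs
    have hne : s(y, z) ≠ e := by
      intro h
      rw [he_def, Sym2.eq_iff] at h
      rcases h with ⟨h1, -⟩ | ⟨-, h2⟩
      · exact hsL (h1 ▸ hy)
      · exact hzs h2
    rw [Function.update_of_ne hne]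
    exact hcross y z hy hz hzs
  have hdF : ∀ t : Fin n, DeterminedBy (openConnIn Lᶜ s t : Set (BondConfig (Fin n))) {z : Sym2 (Fin n) | ¬ z.IsDiag ∧ ∀ v ∈ z, v ∈ Lᶜ} :=
    fun t => IncStarCutVertex.determinedBy_openConnIn_offDiag _ s t
  have he_far : e ∉ {z : Sym2 (Fin n) | ¬ z.IsDiag ∧ ∀ v ∈ z, v ∈ Lᶜ} := by
    rintro ⟨-, h⟩
    exact h x (by rw [he_def]; exact Sym2.mem_mk_right s x) hxL
  -- every moment is the same under `w`, `w[e↦0]`, `w[e↦1]`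
  have same : ∀ (val : unitInterval) (T : Finset (Fin n)), (∀ t ∈ T, t ∉ L) →
      (prodBernoulli (Function.update w e val)).real (⋂ t ∈ T, (openConn s t : Set (BondConfig (Fin n))))
        = (prodBernoulli w).real (⋂ t ∈ T, (openConn s t : Set (BondConfig (Fin n)))) := by
    intro val T hT
    have key : ∀ (u : Sym2 (Fin n) → unitInterval), (∀ y z : Fin n, y ∈ L → z ∉ L → z ≠ s → u s(y, z) = 0) →
        (prodBernoulli u).real (⋂ t ∈ T, (openConn s t : Set (BondConfig (Fin n))))
          = (prodBernoulli u).real (⋂ t ∈ T, (openConnIn Lᶜ s t : Set (BondConfig (Fin n)))) := by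
      intro u hu
      set G : Set (BondConfig (Fin n)) := {ω | ∀ e', u e' = 0 → e' ∉ ω}
      have hG1 : (prodBernoulli u).real G = 1 := real_sureClosed u
      have hωG : ∀ ω ∈ G, ∀ y z : Fin n, y ∈ L → z ∉ L → z ≠ s → s(y, z) ∉ ω :=
        fun ω hω y z hy hz hzs => hω _ (hu y z hy hz hzs)
      refine real_congr_of_sure hG1 fun ω hω => ?_
      simp only [Set.mem_iInter]
      refine forall₂_congr fun t ht => ?_
      rw [bridge_conn_lr L hsL (hωG ω hω) hs1 (hT t ht)]
      exact ⟨fun h => h.2, fun h => ⟨⟨hs1, hs1, SimpleGraph.Reachable.refl _⟩, h⟩⟩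
    have hdet : DeterminedBy (⋂ t ∈ T, (openConnIn Lᶜ s t : Set (BondConfig (Fin n)))) {z : Sym2 (Fin n) | ¬ z.IsDiag ∧ ∀ v ∈ z, v ∈ Lᶜ} := by
      rw [determinedBy_iff]
      intro ω ω' h
      simp only [Set.mem_iInter]
      refine forall₂_congr fun t _ => ?_
      have h' := hdF t
      rw [determinedBy_iff] at h'
      exact h' ω ω' h
    rw [key _ (hcross' val), key w hcross]
    exact real_update_eq_of_determinedBy hdet w he_far val
  have i1 : ∀ t : Fin n, (⋂ t' ∈ ({t} : Finset (Fin n)), (openConn s t' : Set (BondConfig (Fin n)))) = openConn s t := by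
    intro t; ext ω; simp
  have i2 : ∀ t t' : Fin n, (⋂ u ∈ ({t, t'} : Finset (Fin n)), (openConn s u : Set (BondConfig (Fin n)))) = openConn s t ∩ openConn s t' := by
    intro t t'; ext ω; simp
  have i3 : (⋂ u ∈ ({a, b, c} : Finset (Fin n)), (openConn s u : Set (BondConfig (Fin n)))) = openConn s a ∩ openConn s b ∩ openConn s c := by
    ext ω; simp [and_assoc]
  have m1 : ∀ (val : unitInterval) (t : Fin n), t ∉ L →
      (prodBernoulli (Function.update w e val)).real (openConn s t) = (prodBernoulli w).real (openConn s t) := by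
    intro val t ht
    have h := same val {t} (fun u hu => by rw [Finset.mem_singleton] at hu; rw [hu]; exact ht)
    rwa [i1] at h
  have m2 : ∀ (val : unitInterval) (t t' : Fin n), t ∉ L → t' ∉ L →
      (prodBernoulli (Function.update w e val)).real (openConn s t ∩ openConn s t') = (prodBernoulli w).real (openConn s t ∩ openConn s t') := by
    intro val t t' ht ht'
    have h := same val {t, t'} (fun u hu => by
      simp only [Finset.mem_insert, Finset.mem_singleton] at hu
      rcases hu with rfl | rfl
      · exact ht
      · exact ht')
    rwa [i2] at h
  have m3 : ∀ (val : unitInterval),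
      (prodBernoulli (Function.update w e val)).real (openConn s a ∩ openConn s b ∩ openConn s c)
        = (prodBernoulli w).real (openConn s a ∩ openConn s b ∩ openConn s c) := by
    intro val
    have h := same val {a, b, c} (fun u hu => by
      simp only [Finset.mem_insert, Finset.mem_singleton] at hu
      rcases hu with rfl | rfl | rfl
      · exact haL
      · exact hbL
      · exact hcL)
    rwa [i3] at h
  rw [sahiE3_def, sahiE3_def, sahiE3_def, m1 0 a haL, m1 0 b hbL, m1 0 c hcL, m2 0 a b haL hbL, m2 0 a c haL hcL, m2 0 b c hbL hcL, m3 0,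
    m1 1 a haL, m1 1 b hbL, m1 1 c hcL, m2 1 a b haL hbL, m2 1 a c haL hcL, m2 1 b c hbL hcL, m3 1]
  apply le_of_eq
  ring

end IncStar

end Summit.CriticalPhenomena.PercolationContinuityZ3.Theorems
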